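import Literature.Computability.Cryptography.RegevReductionGMSS
import Literature.Computability.QuantumComplexity.PolyCopiesIdxAny
import Literature.Computability.QuantumComplexity.PromiseWrap
import Literature.Computability.Complexity.ZerosPrefixBricks
import HarnessLib

/-!
# Regev's quantum reduction, `GapSVP` form, III: the [GMSS99] step PROVED (parallel truth-table composition)

Topic `Computability/Cryptography` (family `pqc`). Sequel of `RegevReduction.lean` and
`RegevReductionGMSS.lean`, the architecture of the named fact
`Literature.Computability.Cryptography.regev_lwe_to_gapSVP_quantum` (pqc.S19, GapSVP form; Regev,
J. ACM 56 (2009), Thm 1.1 with §3.3). The assembly `regev_lwe_to_gapSVP_quantum_of_worstCase`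
(`RegevReduction.lean`) takes four hypotheses: `h₁`, `h₂` (Regev's Thm 3.1 in worst-case form,
shared verbatim with the SIVP form), `hL` (Lemma 3.20 in machine form) and `hG`, the MACHINE FORM
of Regev's sentence (§3.3, p. 21 of arXiv:2401.03703) *"since [GMSS99] showed that for any `γ ≥ 1`,
there is a polynomial time reduction from `GapSVP_γ` to `GapCVP'_γ` … we obtain … an efficient
quantum algorithm for `GapSVP_{O(n/α)}`"*: a uniform quantum family deciding `GapCVP′_γ` in every
large dimension yields one deciding `GapSVP_γ` in every large dimension. `RegevReductionGMSS.lean`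
reduced `hG` to the generic closure of `PromiseBQP` under Cook reductions (`hC`, not in the tree).
**This file proves `hG` outright** (`Regev2009.gmss_gapSVP_of_gapCVP'_quantum`, every `γ`), so that
pqc.S19 (GapSVP form) now rests on `h₁`, `h₂`, `hL` alone
(`regev_lwe_to_gapSVP_quantum_of_worstCase_tt`, `regev_lwe_to_gapSVP_quantum_of_dgs_tt`).

**The construction** (Bennett–Bernstein–Brassard–Vazirani 1997, §4: polynomially many calls to a
`BQP` machine with error reduced to an inverse polynomial, here the NON-ADAPTIVE case — the GMSS
reduction is a disjunctive truth-table reduction with `n` queries `(B⁽ʲ⁾, bⱼ, d)`, `j < n`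
(Micciancio–Regev 2007, Lemma 5.22) — laid out as parallel copies, in the tree's uniform
Clifford+T model):

1. `F₁ = CWrap.family ⟨hin, Q, gIn⟩` (`CWrapAssembly.lean`): on the indexed input `⟨x, eⱼ⟩`
   (`eⱼ` one-hot) compute the `j`-th GMSS query `hin ⟨x, eⱼ⟩ = GMSS.query x j (dimOf x)` — the
   query writer `GMSSMachine.qFn ∈ FP` of the tree's GMSS machine fed with the fake transcript
   context `⟨x, ⟨1ʲ, ε⟩⟩` (`zerosPrefixFn`), which on the code of `(B, d)` is the code of
   `((B⁽ʲ⁾, bⱼ), d)` (`GMSS.query_encode`) — run the given `GapCVP′` decider `Q` on it, and output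
   the answer bit, forced to `0` when `j ≥ dimOf x` (`gIn`, `GMSSMachine.doneTestFn`);
2. `F₀ =` the majority-amplified `F₁` with `27(|z|+1)` copies (`exists_poly_amplified`,
   `PolyMajority.lean`): two-sided error `≤ 1/(3(|z|+1))` on every input `z` on which `F₁` has a
   `2/3`–`1/3` gap;
3. `C = PolyCopiesIdx.family ⟨F₀, ·, X⟩` (`PolyCopiesIdx.lean`): on `x' = ⟨x, ε⟩` run `|x'| + 1`
   indexed copies of `F₀`, copy `j` on `x' ++ eⱼ = ⟨x, eⱼ⟩`;
4. the classical wrap `CWrap.family ⟨hOut, C, gOut⟩` with `hOut x = ⟨x, ε⟩` and the disjunctive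
   read-out `gOut ⟨x, Y⟩ = anyF ⟨⟨x, ε⟩, Y⟩` (`PolyCopiesIdxAny.lean`), through
   `mem_PromiseBQP_of_isQSolvable` (`PromiseWrap.lean`).

**Correctness.** On the code `x` of `(B, d)` of dimension `n ≥ n₀ ≥ 1` (`n₀` beyond the
threshold of `Q`): by the all-blocks bound `PolyCopiesIdx.kernelProb_segments_ge`, with probability
`≥ 1 − (|x'|+1)/(3(|x'|+1)) = 2/3` every copy `j < n` whose query is a NO instance of `GapCVP′_γ`
answers `0`, every copy `j < n` whose query is a YES (and not a NO) instance answers `1`, and every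
copy `j ≥ n` answers `0`; by MR07 Lemma 5.22 (`MicciancioRegev2007_lemma_5_22`, a theorem of the
tree) the disjunction of the answers is then `1` on YES instances and `0` on NO instances of
`GapSVP_γ` (dimension `0`, where every instance is a YES instance, is excluded by `n₀ ≥ 1`).

Everything here is PROVED; no named fact is introduced.

## References

* O. Regev, *On lattices, learning with errors, random linear codes, and cryptography*, J. ACM 56
  (2009), art. 34 (arXiv:2401.03703), §3.3 (p. 21: the [GMSS99] sentence), Thm 1.1 [Regev2009].
* O. Goldreich, D. Micciancio, S. Safra, J.-P. Seifert, *Approximating shortest lattice vectors is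
  not harder than approximating closest lattice vectors*, IPL 71 (1999), §3, Thm. 1
  [GoldreichMicciancioSafraSeifert1999].
* D. Micciancio, O. Regev, *Worst-case to average-case reductions based on Gaussian measures*,
  SIAM J. Comput. 37 (2007), Def. 5.21, Lemma 5.22 [MicciancioRegev2007].
* C. H. Bennett, E. Bernstein, G. Brassard, U. Vazirani, *Strengths and weaknesses of quantum
  computing*, SIAM J. Comput. 26 (1997) 1510–1523, Thm. 4.13, Thm. 4.14, Cor. 4.15
  [BennettBernsteinBrassardVazirani1997].
* E. Bernstein, U. Vazirani, *Quantum complexity theory*, SIAM J. Comput. 26 (1997), §8.2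
  [BernsteinVazirani1997].
-/

noncomputable section

open Filter Literature.Computability.Complexity Literature.Computability.Cryptography.LWE
  Literature.Algebra.EuclideanLattices Literature.Computability.QuantumComplexity
open scoped ENNReal Topology

namespace Literature.Computability.Cryptography

namespace Regev2009

/-! ## Part A. The classical pieces as `FP` string functions -/

namespace GMSSParallel

open _root_.Computability Polynomial Complexity.Brick Plumb HashBricks GMSS GMSSMachine

/-! ### Definitions -/

/-- The GMSS machine context `⟨x, ⟨1ʲ, ε⟩⟩` read off the indexed input `⟨x, eⱼ⟩`
(`zerosPrefixFn eⱼ = 1ʲ`): a fake transcript of length `j` without a YES answer. [folklore] -/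
def gmssCtx : List Bool → List Bool := fanoutFn fstF (fanoutFn (zerosPrefixFn ∘ sndF) fun _ => [])

/-- **The query extractor** `hin ⟨x, eⱼ⟩ = GMSS.query x j (dimOf x)`: the query writer `qFn` of the
GMSS machine on the context `⟨x, ⟨1ʲ, ε⟩⟩`, with its tag bit dropped.
[cite: GoldreichMicciancioSafraSeifert1999, §3 (the j-th query (B⁽ʲ⁾, bⱼ, d))] -/
def hin : List Bool → List Bool := dropFn ∘ fanoutFn (fun _ => [true]) (qFn ∘ gmssCtx)

/-- The test `[dimOf x ≤ j]` on the wrapped record `⟨⟨x, eⱼ⟩, y⟩` (`doneTestFn` of the GMSS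
machine on the context). [folklore] -/
def doneC : List Bool → List Bool := doneTestFn ∘ gmssCtx ∘ fstF

/-- `[y.headD false]` on a record `⟨z, y⟩`: the first bit of `y ++ [0]`. [folklore] -/
def headDF : List Bool → List Bool := takeFn ∘ fanoutFn (fun _ => [true]) (appF ∘ fanoutFn sndF fun _ => [false])

/-- **The inner post-processor** on `⟨⟨x, eⱼ⟩, y⟩` (`y` the measured output of the `GapCVP′`
decider on the `j`-th query): `[0]` if `j ≥ dimOf x` (no such query), else the answer bit of `y`.
[folklore] -/
def gIn : List Bool → List Bool := iteFn doneC (fun _ => [false]) headDF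

/-- **The outer pre-processor** `x ↦ ⟨x, ε⟩` (so that copy `j` of the indexed copies receives
`⟨x, ε⟩ ++ eⱼ = ⟨x, eⱼ⟩`). [folklore] -/
def hOut : List Bool → List Bool := fanoutFn (fun z => z) fun _ => []

/-- **The outer post-processor** on `⟨x, Y⟩` (`Y` the measured string of the indexed copies run on
`⟨x, ε⟩`): the disjunctive read-out `anyF ⟨⟨x, ε⟩, Y⟩` ("YES iff some call answered YES").
[cite: MicciancioRegev2007, Lemma 5.22 (disjunctive combination)] -/
def gOut (P : PolyCopies.Params) : List Bool → List Bool := PolyCopiesIdx.anyF P ∘ fanoutFn (hOut ∘ fstF) sndF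

/-! ### Polynomial time -/

/-- `gmssCtx ∈ FP`. [folklore] -/
theorem gmssCtx_mem_FP : gmssCtx ∈ FP :=
  fanoutFn_mem_FP fstF_mem_FP (fanoutFn_mem_FP (comp_mem_FP zerosPrefixFn_mem_FP sndF_mem_FP) (const_mem_FP _))

/-- `hin ∈ FP` (the GMSS query writer is polynomial time, `GMSSMachine.qFn_mem_FP`).
[cite: MicciancioRegev2007, Lemma 5.22 (the reduction runs in polynomial time)] -/
theorem hin_mem_FP : hin ∈ FP :=
  comp_mem_FP dropFn_mem_FP (fanoutFn_mem_FP (const_mem_FP _) (comp_mem_FP qFn_mem_FP gmssCtx_mem_FP))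

/-- `doneC ∈ FP`. [folklore] -/
theorem doneC_mem_FP : doneC ∈ FP := comp_mem_FP doneTestFn_mem_FP (comp_mem_FP gmssCtx_mem_FP fstF_mem_FP)

/-- `headDF ∈ FP`. [folklore] -/
theorem headDF_mem_FP : headDF ∈ FP :=
  comp_mem_FP takeFn_mem_FP (fanoutFn_mem_FP (const_mem_FP _) (comp_mem_FP appF_mem_FP (fanoutFn_mem_FP sndF_mem_FP (const_mem_FP _))))

/-- `gIn ∈ FP`. [folklore] -/
theorem gIn_mem_FP : gIn ∈ FP := iteFn_mem_FP doneC_mem_FP (const_mem_FP _) headDF_mem_FP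

/-- `hOut ∈ FP`. [folklore] -/
theorem hOut_mem_FP : hOut ∈ FP := fanoutFn_mem_FP (PolyTimeComputable.id _) (const_mem_FP _)

/-- `gOut ∈ FP`. [folklore] -/
theorem gOut_mem_FP (P : PolyCopies.Params) : gOut P ∈ FP :=
  comp_mem_FP PolyCopiesIdx.anyF_mem_FP (fanoutFn_mem_FP (comp_mem_FP hOut_mem_FP fstF_mem_FP) sndF_mem_FP)

/-! ### Semantics -/

/-- The one-hot word `eⱼ ∈ {0,1}^K` (`j < K`) is `0ʲ 1 0^{K-j-1}`. [folklore] -/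
theorem ofFn_oneHot {K j : ℕ} (hj : j < K) :
    (List.ofFn fun j' : Fin K => decide ((j' : ℕ) = j)) = List.replicate j false ++ true :: List.replicate (K - j - 1) false := by
  apply List.ext_getElem
  · simp only [List.length_ofFn, List.length_append, List.length_replicate, List.length_cons]; omega
  · intro i h₁ h₂
    rw [List.getElem_ofFn]
    rcases lt_trichotomy i j with h | h | h
    · rw [List.getElem_append_left (by simpa using h)]
      simp only [List.getElem_replicate]
      exact decide_eq_false (by omega)
    · subst h
      rw [List.getElem_append_right (by simp)]
      simp
    · rw [List.getElem_append_right (by simp; omega)]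
      have : i - (List.replicate j false).length = (i - j - 1) + 1 := by simp; omega
      simp only [this, List.getElem_cons_succ, List.getElem_replicate]
      exact decide_eq_false (by omega)

/-- `⟨x, ε⟩ ++ e = ⟨x, e⟩` (the pairing is its first component's code followed by the second
component verbatim). [folklore] -/
theorem hOut_append (x e : List Bool) : hOut x ++ e = boolPair x e := by
  simp [hOut, boolPair]

/-- `hOut x = ⟨x, ε⟩`. [folklore] -/
theorem hOut_apply (x : List Bool) : hOut x = boolPair x [] := by simp [hOut]

/-- The context on an indexed input with a zero-led index word: `gmssCtx ⟨x, 0ʲ 1 r⟩ = ⟨x, ⟨1ʲ, ε⟩⟩`. [folklore] -/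
theorem gmssCtx_apply (x r : List Bool) (j : ℕ) :
    gmssCtx (boolPair x (List.replicate j false ++ true :: r)) = boolPair x (boolPair (ones j) []) := by
  simp [gmssCtx, zerosPrefixFn_replicate_append]

/-- **The query extractor computes the syntactic GMSS query**: `hin ⟨x, 0ʲ 1 r⟩ = GMSS.query x j (dimOf x)`.
[cite: GoldreichMicciancioSafraSeifert1999, §3] -/
theorem hin_apply (x r : List Bool) (j : ℕ) :
    hin (boolPair x (List.replicate j false ++ true :: r)) = query x j (dimOf x) := by
  rw [hin, Function.comp_apply, fanoutFn_apply, Function.comp_apply, gmssCtx_apply, dropFn_boolPair]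
  simp [qFn, tlen, ones]

/-- **On the code of `(B, d)` and `j < n` the extracted query is the code of the `j`-th GMSS instance
`((B⁽ʲ⁾, bⱼ), d)`.** [cite: GoldreichMicciancioSafraSeifert1999, §3; MicciancioRegev2007 Lemma 5.22] -/
theorem hin_encode (I : LatticeInstance) (d : ℚ) (j : Fin I.n) (r : List Bool) :
    hin (boolPair (gapSVPInstanceEncoding.encode (I, d)) (List.replicate j false ++ true :: r)) =
      gapCVPInstanceEncoding.encode (gmssInstance I j, d) := by
  rw [hin_apply, dimOf_encode, query_encode]

/-- The test on a record: `doneC ⟨⟨x, 0ʲ 1 r⟩, y⟩ = [dimOf x ≤ j]`. [folklore] -/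
theorem doneC_apply (x r y : List Bool) (j : ℕ) :
    doneC (boolPair (boolPair x (List.replicate j false ++ true :: r)) y) = [decide (dimOf x ≤ j)] := by
  rw [doneC, Function.comp_apply, Function.comp_apply, fstF_boolPair, gmssCtx_apply]
  simp [doneTestFn, tlen, ones]

/-- `headDF ⟨z, y⟩ = [y.headD false]`. [folklore] -/
theorem headDF_apply (z y : List Bool) : headDF (boolPair z y) = [y.headD false] := by
  rw [headDF, Function.comp_apply, fanoutFn_apply, Function.comp_apply, fanoutFn_apply, sndF_boolPair, appF_boolPair,
    takeFn_boolPair]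
  cases y <;> simp

/-- **Semantics of the inner post-processor.** [folklore] -/
theorem gIn_apply (x r y : List Bool) (j : ℕ) :
    gIn (boolPair (boolPair x (List.replicate j false ++ true :: r)) y) = if dimOf x ≤ j then [false] else [y.headD false] := by
  rw [gIn, iteFn_apply (doneC_apply x r y j)]
  by_cases h : dimOf x ≤ j
  · rw [decide_eq_true h, if_pos rfl, if_pos h]
  · rw [decide_eq_false h, if_neg h, headDF_apply]; rfl

/-- **Semantics of the outer post-processor**: `gOut ⟨x, Y⟩ = anyF ⟨⟨x, ε⟩, Y⟩`. [folklore] -/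
theorem gOut_apply (P : PolyCopies.Params) (x Y : List Bool) : gOut P (boolPair x Y) = PolyCopiesIdx.anyF P (boolPair (hOut x) Y) := by
  simp [gOut]

/-! ### Head bits versus the acceptance prefix -/

/-- A string starts with `1` iff its head bit (default `0`) is `1`. [folklore] -/
theorem prefix_true_iff_headD (y : List Bool) : [true] <+: y ↔ y.headD false = true := by
  cases y with
  | nil => simp
  | cons b l => cases b <;> simp

end GMSSParallel

/-! ## Part B. The inner family: one GMSS call -/

section Inner

open GMSSParallel Literature.Algebra.EuclideanLattices.GMSS

variable (P₁ : CWrap.Params) (hh : P₁.h = hin) (hg : P₁.g = gIn)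

include hh hg

/-- **One GMSS call, YES query**: if `j < dimOf x` and the wrapped decider accepts the `j`-th query
with probability `≥ 2/3`, the inner family accepts `⟨x, eⱼ⟩` with probability `≥ 2/3`.
[cite: BernsteinVazirani1997, §8.2 (classical computation inside quantum machines)] -/
theorem inner_accept_ge (x r : List Bool) {j : ℕ} (hj : ¬ dimOf x ≤ j)
    (hq : 2 / 3 ≤ P₁.F.acceptProbOn 0 (query x j (dimOf x))) :
    2 / 3 ≤ (CWrap.family P₁).acceptProbOn 0 (boolPair x (List.replicate j false ++ true :: r)) := by
  set z := boolPair x (List.replicate j false ++ true :: r) with hz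
  have hker := CWrap.kernelProb_family_ge P₁ z (fun _ => {y | [true] <+: y})
  rw [hh, hg, hin_apply, kernelProb_prefix_true_eq_acceptProbOn] at hker
  have hsub : {w | ∃ y ∈ ({y | [true] <+: y} : Set (List Bool)), gIn (boolPair z y) <+: w} ⊆ {w | [true] <+: w} := by
    rintro w ⟨y, hy, hw⟩
    rw [Set.mem_setOf_eq, prefix_true_iff_headD] at hy
    rw [hz, gIn_apply, if_neg hj, hy] at hw
    exact hw
  rw [← kernelProb_prefix_true_eq_acceptProbOn]
  exact (hq.trans hker).trans ((CWrap.family P₁).kernelProb_mono 0 z hsub)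

/-- **One GMSS call, NO query**: if `j < dimOf x` and the wrapped decider accepts the `j`-th query
with probability `≤ 1/3`, the inner family accepts `⟨x, eⱼ⟩` with probability `≤ 1/3`.
[cite: BernsteinVazirani1997, §8.2 (classical computation inside quantum machines)] -/
theorem inner_accept_le (x r : List Bool) {j : ℕ} (hj : ¬ dimOf x ≤ j)
    (hq : P₁.F.acceptProbOn 0 (query x j (dimOf x)) ≤ 1 / 3) :
    (CWrap.family P₁).acceptProbOn 0 (boolPair x (List.replicate j false ++ true :: r)) ≤ 1 / 3 := by
  set z := boolPair x (List.replicate j false ++ true :: r) with hz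
  have hker := CWrap.kernelProb_family_ge P₁ z (fun _ => {y | [true] <+: y}ᶜ)
  rw [hh, hg, hin_apply] at hker
  have hc := P₁.F.kernelProb_add_kernelProb_compl 0 (query x j (dimOf x)) {y | [true] <+: y}
  rw [kernelProb_prefix_true_eq_acceptProbOn] at hc
  have hsub : {w | ∃ y ∈ ({y | [true] <+: y}ᶜ : Set (List Bool)), gIn (boolPair z y) <+: w} ⊆ {w | [false] <+: w} := by
    rintro w ⟨y, hy, hw⟩
    rw [Set.mem_compl_iff, Set.mem_setOf_eq, prefix_true_iff_headD, Bool.not_eq_true] at hy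
    rw [hz, gIn_apply, if_neg hj, hy] at hw
    exact hw
  have h1 := hker.trans ((CWrap.family P₁).kernelProb_mono 0 z hsub)
  have h2 := kernelProb_add_kernelProb_le_one (CWrap.family P₁) 0 z disjoint_prefix_true_false
  rw [kernelProb_prefix_true_eq_acceptProbOn] at h2
  linarith

omit hh in
/-- **One GMSS call, no query** (`j ≥ dimOf x`): the inner family accepts `⟨x, eⱼ⟩` with
probability `≤ 1/3` (indeed `0`: the answer is forced to `0`). [folklore] -/
theorem inner_accept_le_of_le (x r : List Bool) {j : ℕ} (hj : dimOf x ≤ j) :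
    (CWrap.family P₁).acceptProbOn 0 (boolPair x (List.replicate j false ++ true :: r)) ≤ 1 / 3 := by
  set z := boolPair x (List.replicate j false ++ true :: r) with hz
  have hker := CWrap.kernelProb_family_ge P₁ z (fun _ => Set.univ)
  rw [hg, P₁.F.kernelProb_univ_eq_one] at hker
  have hsub : {w | ∃ y ∈ (Set.univ : Set (List Bool)), gIn (boolPair z y) <+: w} ⊆ {w | [false] <+: w} := by
    rintro w ⟨y, -, hw⟩
    rw [hz, gIn_apply, if_pos hj] at hw
    exact hw
  have h1 := hker.trans ((CWrap.family P₁).kernelProb_mono 0 z hsub)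
  have h2 := kernelProb_add_kernelProb_le_one (CWrap.family P₁) 0 z disjoint_prefix_true_false
  rw [kernelProb_prefix_true_eq_acceptProbOn] at h2
  linarith

end Inner

/-! ## Part C. Error reduction and the indexed copies: all calls at once -/

section Copies

open Polynomial GMSSParallel Literature.Algebra.EuclideanLattices.GMSS

/-- The head-`1` event. [folklore] -/
def HT : Set (List Bool) := {s | s.headD false = true}

/-- The head-`0` event. [folklore] -/
def HF : Set (List Bool) := {s | s.headD false = false}

/-- `Pr[head = 1] = acceptance probability`. [folklore] -/
theorem kernelProb_HT (F : QCircuitFamily cliffordT) (z : List Bool) : F.kernelProb 0 z HT = F.acceptProbOn 0 z := by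
  rw [← kernelProb_prefix_true_eq_acceptProbOn]
  congr 1
  ext y
  exact (prefix_true_iff_headD y).symm

/-- `Pr[head = 0] = 1 − acceptance probability`. [folklore] -/
theorem kernelProb_HF (F : QCircuitFamily cliffordT) (z : List Bool) : F.kernelProb 0 z HF = 1 - F.acceptProbOn 0 z := by
  have hc := F.kernelProb_add_kernelProb_compl 0 z HT
  have e : HTᶜ = HF := by
    ext y
    simp [HT, HF]
  rw [e, kernelProb_HT] at hc
  linarith

open Classical in
/-- **The target event of copy `j`** for the input `(B, d)` of dimension `n`: for `j < n`, head `0`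
if the `j`-th GMSS instance is a NO instance of `GapCVP′_γ`, head `1` if it is a YES (and not a NO)
instance, anything otherwise; for `j ≥ n`, head `0`. [cite: MicciancioRegev2007, Lemma 5.22] -/
def target (γ : ℕ → ℝ) (p : GapSVPInstance) (j : ℕ) : Set (List Bool) :=
  if h : j < p.1.n then
    if (gmssInstance p.1 ⟨j, h⟩, p.2) ∈ GapCVP'.no γ then HF
    else if (gmssInstance p.1 ⟨j, h⟩, p.2) ∈ GapCVP'.yes γ then HT else Set.univ
  else HF

/-- The error bound of the amplified family in closed form: `1/(3(|z|+1))`. [folklore] -/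
theorem amp_bound_eq (z : List Bool) :
    1 / (4 * ((C 27 * X + C 26 : Polynomial ℕ).eval z.length + 1 : ℕ) * (1 / 6 : ℝ) ^ 2) = 1 / (3 * ((z.length : ℝ) + 1)) := by
  have e : (((C 27 * X + C 26 : Polynomial ℕ).eval z.length + 1 : ℕ) : ℝ) = 27 * ((z.length : ℝ) + 1) := by
    push_cast [eval_add, eval_mul, eval_C, eval_X]
    ring
  rw [e]
  ring

variable {γ : ℕ → ℝ} {Q : UniformQCircuitFamily} {n₀ : ℕ}
  (hQ : ∀ p : GapCVPInstance, n₀ ≤ p.1.I.n →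
    (p ∈ GapCVP'.yes γ → 2 / 3 ≤ Q.acceptProb p.encode) ∧ (p ∈ GapCVP'.no γ → Q.acceptProb p.encode ≤ 1 / 3))
  (P₁ : CWrap.Params) (hh : P₁.h = hin) (hg : P₁.g = gIn) (hF : P₁.F = Q.family)
  {F₀ : QCircuitFamily cliffordT}
  (hF₀ : ∀ z : List Bool,
    (1 / 2 + 1 / 6 ≤ (CWrap.family P₁).acceptProbOn 0 z →
      1 - 1 / (4 * ((C 27 * X + C 26 : Polynomial ℕ).eval z.length + 1 : ℕ) * (1 / 6 : ℝ) ^ 2) ≤ F₀.acceptProbOn 0 z) ∧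
    ((CWrap.family P₁).acceptProbOn 0 z ≤ 1 / 2 - 1 / 6 →
      F₀.acceptProbOn 0 z ≤ 1 / (4 * ((C 27 * X + C 26 : Polynomial ℕ).eval z.length + 1 : ℕ) * (1 / 6 : ℝ) ^ 2)))

include hQ hh hg hF hF₀

/-- **Copy `j` hits its target with probability `≥ 1 − 1/(3(|z|+1))`** on `z = ⟨x, eⱼ⟩`, `x` the code
of `(B, d)` of dimension `≥ n₀`. [cite: BennettBernsteinBrassardVazirani1997, Thm. 4.13 (error reduction) with MicciancioRegev2007 Lemma 5.22] -/
theorem kernelProb_target_ge (p : GapSVPInstance) (hp : n₀ ≤ p.1.n) (j : ℕ) (r : List Bool) :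
    1 - 1 / (3 * (((boolPair p.encode (List.replicate j false ++ true :: r)).length : ℝ) + 1)) ≤
      F₀.kernelProb 0 (boolPair p.encode (List.replicate j false ++ true :: r)) (target γ p j) := by
  obtain ⟨I, d⟩ := p
  have hdim : dimOf (GapSVPInstance.encode (I, d)) = I.n := dimOf_encode I d
  -- the inner family on this input (Part B), recorded before the input string is generalized
  have hle := fun (hj : ¬ dimOf (GapSVPInstance.encode (I, d)) ≤ j)
      (hq : P₁.F.acceptProbOn 0 (query (GapSVPInstance.encode (I, d)) j (dimOf (GapSVPInstance.encode (I, d)))) ≤ 1 / 3) =>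
    inner_accept_le P₁ hh hg (GapSVPInstance.encode (I, d)) r hj hq
  have hge := fun (hj : ¬ dimOf (GapSVPInstance.encode (I, d)) ≤ j)
      (hq : 2 / 3 ≤ P₁.F.acceptProbOn 0 (query (GapSVPInstance.encode (I, d)) j (dimOf (GapSVPInstance.encode (I, d))))) =>
    inner_accept_ge P₁ hh hg (GapSVPInstance.encode (I, d)) r hj hq
  have hle' := fun (hj : dimOf (GapSVPInstance.encode (I, d)) ≤ j) =>
    inner_accept_le_of_le P₁ hg (GapSVPInstance.encode (I, d)) r hj
  generalize boolPair (GapSVPInstance.encode (I, d)) (List.replicate j false ++ true :: r) = z at hle hge hle' ⊢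
  have hδ := amp_bound_eq z
  -- the two ways of hitting the target
  have caseF : (CWrap.family P₁).acceptProbOn 0 z ≤ 1 / 3 →
      1 - 1 / (3 * ((z.length : ℝ) + 1)) ≤ F₀.kernelProb 0 z HF := fun h1 => by
    have h := (hF₀ z).2 (by linarith)
    rw [hδ] at h
    rw [kernelProb_HF]
    linarith
  have caseT : 2 / 3 ≤ (CWrap.family P₁).acceptProbOn 0 z →
      1 - 1 / (3 * ((z.length : ℝ) + 1)) ≤ F₀.kernelProb 0 z HT := fun h1 => by
    have h := (hF₀ z).1 (by linarith)
    rw [hδ] at h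
    rw [kernelProb_HT]
    exact h
  simp only [target]
  by_cases hj : j < I.n
  · rw [dif_pos hj]
    have hjd : ¬ dimOf (GapSVPInstance.encode (I, d)) ≤ j := by rw [hdim]; omega
    have hquery : query (GapSVPInstance.encode (I, d)) j (dimOf (GapSVPInstance.encode (I, d))) =
        GapCVPInstance.encode (gmssInstance I ⟨j, hj⟩, d) := by
      rw [hdim]; exact query_encode I d ⟨j, hj⟩
    rw [hquery, hF] at hle hge
    have hQj := hQ (gmssInstance I ⟨j, hj⟩, d) hp
    by_cases hno : (gmssInstance I ⟨j, hj⟩, d) ∈ GapCVP'.no γ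
    · rw [if_pos hno]
      exact caseF (hle hjd (hQj.2 hno))
    rw [if_neg hno]
    by_cases hyes : (gmssInstance I ⟨j, hj⟩, d) ∈ GapCVP'.yes γ
    · rw [if_pos hyes]
      exact caseT (hge hjd (hQj.1 hyes))
    · rw [if_neg hyes, F₀.kernelProb_univ_eq_one]
      have : 0 ≤ 1 / (3 * ((z.length : ℝ) + 1)) := by positivity
      linarith
  · rw [dif_neg hj]
    exact caseF (hle' (by rw [hdim]; omega))

variable (P₂ : PolyCopies.Params) (hF₂ : P₂.F = F₀) (hK₂ : P₂.pK = X)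

include hF₂ hK₂

/-- **All calls at once.** On `x' = ⟨x, ε⟩`, `x` the code of `(B, d)` of dimension `≥ n₀`, the
indexed copies of the error-reduced inner family produce, with probability `≥ 2/3`, a string every
segment `j < |x'| + 1` of which lies in its target event (union bound
`PolyCopiesIdx.kernelProb_segments_ge` with `δ = 1/(3(|x'|+1))`).
[cite: BennettBernsteinBrassardVazirani1997, Thm. 4.14 (proof: polynomially many calls with inverse-polynomial error)] -/
theorem kernelProb_all_targets_ge (p : GapSVPInstance) (hp : n₀ ≤ p.1.n) :
    2 / 3 ≤ (PolyCopiesIdx.family P₂).kernelProb 0 (hOut p.encode)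
      {w | ∀ j : Fin (PolyCopiesIdx.K P₂ (hOut p.encode).length), PolyCopiesIdx.segment P₂ (hOut p.encode).length w j ∈ target γ p j} := by
  have happ : ∀ e, hOut p.encode ++ e = boolPair p.encode e := hOut_append p.encode
  generalize hOut p.encode = x' at happ ⊢
  have hK : PolyCopiesIdx.K P₂ x'.length = x'.length + 1 := by
    rw [PolyCopiesIdx.K, hK₂, eval_X]
  have hK1 : (1 : ℝ) ≤ PolyCopiesIdx.K P₂ x'.length := by
    rw [hK]; push_cast; linarith [Nat.cast_nonneg (α := ℝ) x'.length]
  have hKpos : (0 : ℝ) < PolyCopiesIdx.K P₂ x'.length := by linarith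
  have hδ1 : 1 / (3 * (PolyCopiesIdx.K P₂ x'.length : ℝ)) ≤ 1 := by
    rw [div_le_one (by linarith)]; linarith
  refine le_trans (le_of_eq ?_) (PolyCopiesIdx.kernelProb_segments_ge (P := P₂) x' (fun j => target γ p j)
    (δ := 1 / (3 * (PolyCopiesIdx.K P₂ x'.length : ℝ))) hδ1 fun j => ?_)
  · field_simp
    ring
  · -- block `j`: the copy runs on `x' ++ e_j = ⟨x, e_j⟩`
    have hin' : PolyCopiesIdx.inputIdx P₂ x' j =
        boolPair p.encode (List.replicate j false ++ true :: List.replicate (PolyCopiesIdx.K P₂ x'.length - j - 1) false) := by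
      rw [PolyCopiesIdx.inputIdx, ofFn_oneHot j.isLt, happ]
    rw [hin', hF₂]
    refine le_trans ?_ (kernelProb_target_ge hQ P₁ hh hg hF hF₀ p hp j _)
    -- `1/(3(|z|+1)) ≤ 1/(3K)` since `|z| + 1 ≥ K`
    have hlen : (PolyCopiesIdx.K P₂ x'.length : ℝ) ≤
        ((boolPair p.encode (List.replicate (j : ℕ) false ++ true :: List.replicate (PolyCopiesIdx.K P₂ x'.length - j - 1) false)).length : ℝ) + 1 := by
      rw [← happ, List.length_append]
      have e : ((PolyCopiesIdx.K P₂ x'.length : ℕ) : ℝ) = x'.length + 1 := by exact_mod_cast hK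
      push_cast
      linarith [Nat.cast_nonneg (α := ℝ)
        (List.replicate (j : ℕ) false ++ true :: List.replicate (PolyCopiesIdx.K P₂ x'.length - j - 1) false).length]
    have := one_div_le_one_div_of_le (by linarith : (0 : ℝ) < 3 * (PolyCopiesIdx.K P₂ x'.length : ℝ)) (by linarith : 
      3 * (PolyCopiesIdx.K P₂ x'.length : ℝ) ≤ 3 * (((boolPair p.encode (List.replicate (j : ℕ) false ++ true ::
        List.replicate (PolyCopiesIdx.K P₂ x'.length - j - 1) false)).length : ℝ) + 1))
    linarith

end Copies

/-! ## Part D. `GapSVP_γ` restricted to large dimensions is in `PromiseBQP` -/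

section Promise

open Polynomial GMSSParallel Literature.Algebra.EuclideanLattices.GMSS

/-- **The [GMSS99] step with a bounded-error quantum `GapCVP′` decider.** If a uniform quantum family
decides `GapCVP′_γ` (thresholds `2/3`–`1/3`) on every instance of dimension `≥ n₀`, then for
`n₁ = max n₀ 1` the promise problem "`GapSVP_γ` restricted to dimensions `≥ n₁`" is in `PromiseBQP`.
[cite: Regev2009, §3.3 (p. 21, the GMSS99 sentence); MicciancioRegev2007 Lemma 5.22; BennettBernsteinBrassardVazirani1997 Thm. 4.14] -/
theorem restrict_gapSVP_mem_PromiseBQP_of_gapCVP' {γ : ℕ → ℝ} {Q : UniformQCircuitFamily} {n₀ : ℕ}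
    (hQ : ∀ p : GapCVPInstance, n₀ ≤ p.1.I.n →
      (p ∈ GapCVP'.yes γ → 2 / 3 ≤ Q.acceptProb p.encode) ∧ (p ∈ GapCVP'.no γ → Q.acceptProb p.encode ≤ 1 / 3)) :
    PromiseProblem.ofEncoding gapSVPInstanceEncoding
        {p | p ∈ GapSVP.yes γ ∧ p.1.n ∈ Set.Ici (max n₀ 1)} {p | p ∈ GapSVP.no γ ∧ p.1.n ∈ Set.Ici (max n₀ 1)} ∈
      PromiseBQP := by
  classical
  -- the inner family
  obtain ⟨P₁, hh, hg, hF⟩ := CWrap.exists_params hin_mem_FP gIn_mem_FP Q.isUniform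
  have h1free : (CWrap.family P₁).IsOracleFree := CWrap.family_isOracleFree P₁ (hF ▸ Q.isOracleFree)
  have h1unif : (CWrap.family P₁).IsUniform := CWrap.family_isUniform P₁ (hF ▸ Q.isUniform)
  -- error reduction
  obtain ⟨F₀, h0free, h0unif, hF₀⟩ := exists_poly_amplified h1free h1unif (C 27 * X + C 26) (η := 1 / 6) (by norm_num)
  -- the indexed copies
  obtain ⟨pF, hpF⟩ := QCircuitFamily.IsUniform.isPolySize' h0unif
  obtain ⟨P₂, hF₂, hK₂⟩ : ∃ P₂ : PolyCopies.Params, P₂.F = F₀ ∧ P₂.pK = X := ⟨⟨F₀, pF, fun n => (hpF n).2, X⟩, rfl, rfl⟩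
  have h2free : (PolyCopiesIdx.family P₂).IsOracleFree := PolyCopiesIdx.family_isOracleFree P₂ (hF₂ ▸ h0free)
  have h2unif : (PolyCopiesIdx.family P₂).IsUniform := PolyCopiesIdx.family_isUniform P₂ (hF₂ ▸ h0unif)
  have hn₀ : n₀ ≤ max n₀ 1 := le_max_left _ _
  -- the search relation: all targets hit, on well-formed inputs of large dimension
  obtain ⟨R, hRdef⟩ : ∃ R : List Bool → Set (List Bool), ∀ x', R x' =
      {w | ∀ p : GapSVPInstance, x' = hOut p.encode → max n₀ 1 ≤ p.1.n →
        ∀ j : Fin (PolyCopiesIdx.K P₂ x'.length), PolyCopiesIdx.segment P₂ x'.length w j ∈ target γ p j} :=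
    ⟨_, fun _ => rfl⟩
  have hR : IsQSolvable R := by
    refine ⟨PolyCopiesIdx.family P₂, h2free, h2unif, fun x' => ?_⟩
    by_cases hx : ∃ p : GapSVPInstance, x' = hOut p.encode ∧ max n₀ 1 ≤ p.1.n
    · obtain ⟨p, hpx, hp⟩ := hx
      have hRe : R x' = {w | ∀ j : Fin (PolyCopiesIdx.K P₂ x'.length),
          PolyCopiesIdx.segment P₂ x'.length w j ∈ target γ p j} := by
        rw [hRdef]
        ext w
        refine ⟨fun hw => hw p hpx hp, fun hw p' hp' _ => ?_⟩
        have hinj : p' = p := by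
          have e1 : boolPair p'.encode [] = boolPair p.encode [] := by rw [← hOut_apply, ← hOut_apply, ← hp', ← hpx]
          have e2 := congrArg boolUnpair e1
          simp only [boolUnpair_boolPair, Prod.mk.injEq, and_true] at e2
          exact gapSVPInstanceEncoding.encode_injective e2
        subst hinj
        exact hw
      rw [hRe, hpx]
      exact kernelProb_all_targets_ge hQ P₁ hh hg hF hF₀ P₂ hF₂ hK₂ p (hn₀.trans hp)
    · have hRe : R x' = Set.univ := by
        rw [hRdef]
        ext w
        simp only [Set.mem_univ, iff_true, Set.mem_setOf_eq]
        intro p hp' hp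
        exact absurd ⟨p, hp', hp⟩ hx
      rw [hRe, (PolyCopiesIdx.family P₂).kernelProb_univ_eq_one]
      norm_num
  refine mem_PromiseBQP_of_isQSolvable _ hOut (gOut P₂) hOut_mem_FP (gOut_mem_FP P₂) hR ?_ ?_
  · -- YES instances: some GMSS call is a YES instance, and its copy answered `1`
    rintro x ⟨p, ⟨hpyes, hpn⟩, rfl⟩ Y hY
    obtain ⟨I, d⟩ := p
    have hpn' : max n₀ 1 ≤ I.n := hpn
    have hn : I.n ≠ 0 := by have := le_max_right n₀ 1; omega
    rw [hRdef] at hY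
    have hall := hY (I, d) rfl hpn'
    obtain ⟨i, hi⟩ := (MicciancioRegev2007_lemma_5_22 γ I hn d).1.1 hpyes
    -- the witness call is not a NO instance (the decider separates YES from NO beyond `n₀`)
    have hnot : (gmssInstance I i, d) ∉ GapCVP'.no γ := fun hno => by
      have h := hQ (gmssInstance I i, d) (hn₀.trans hpn')
      have := (h.1 hi).trans (h.2 hno)
      norm_num at this
    have hK : PolyCopiesIdx.K P₂ (hOut (GapSVPInstance.encode (I, d))).length = (hOut (GapSVPInstance.encode (I, d))).length + 1 := by
      rw [PolyCopiesIdx.K, hK₂, eval_X]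
    have hiK : (i : ℕ) < PolyCopiesIdx.K P₂ (hOut (GapSVPInstance.encode (I, d))).length := by
      rw [hK, hOut_apply, length_boolPair]
      have h1 := n_le_length_encode_gapSVP I d
      change I.n ≤ (GapSVPInstance.encode (I, d)).length at h1
      have h2 := i.isLt
      omega
    have hseg := hall ⟨i, hiK⟩
    simp only [target, dif_pos i.isLt, Fin.eta, if_neg hnot, if_pos hi, HT, Set.mem_setOf_eq,
      PolyCopiesIdx.headD_segment] at hseg
    have e : PolyCopiesIdx.anyF P₂ (boolPair (hOut (GapSVPInstance.encode (I, d))) Y) = [true] :=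
      (PolyCopiesIdx.anyF_boolPair_eq_true_iff _ _).2 ⟨i, hiK, hseg⟩
    rw [gOut_apply]
    change [true] <+: PolyCopiesIdx.anyF P₂ (boolPair (hOut (GapSVPInstance.encode (I, d))) Y)
    rw [e]
  · -- NO instances: every call is a NO instance or out of range, and every copy answered `0`
    rintro x ⟨p, ⟨hpno, hpn⟩, rfl⟩ Y hY
    obtain ⟨I, d⟩ := p
    have hpn' : max n₀ 1 ≤ I.n := hpn
    have hn : I.n ≠ 0 := by have := le_max_right n₀ 1; omega
    rw [hRdef] at hY
    have hall := hY (I, d) rfl hpn'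
    have hallno := (MicciancioRegev2007_lemma_5_22 γ I hn d).2 hpno
    have e : PolyCopiesIdx.anyF P₂ (boolPair (hOut (GapSVPInstance.encode (I, d))) Y) = [false] := by
      refine (PolyCopiesIdx.anyF_boolPair_eq_false_iff _ _).2 fun j hj => ?_
      have hseg := hall ⟨j, hj⟩
      by_cases hjn : j < I.n
      · simp only [target, dif_pos hjn, if_pos (hallno ⟨j, hjn⟩), HF, Set.mem_setOf_eq,
          PolyCopiesIdx.headD_segment] at hseg
        exact hseg
      · simp only [target, dif_neg hjn, HF, Set.mem_setOf_eq, PolyCopiesIdx.headD_segment] at hseg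
        exact hseg
    rw [gOut_apply]
    change [false] <+: PolyCopiesIdx.anyF P₂ (boolPair (hOut (GapSVPInstance.encode (I, d))) Y)
    rw [e]

end Promise

/-! ## Part E. `hG` proved, and the assemblies of pqc.S19 (GapSVP form) without `hG` -/

/-- **The [GMSS99] step of Regev's §3.3 at machine level, PROVED** (every factor `γ`): if some
uniform quantum family decides `GapCVP′_γ` in every large dimension, then some uniform quantum
family decides `GapSVP_γ` in every large dimension — the GMSS disjunctive truth-table reduction
(MR07 Lemma 5.22) run with `n` parallel error-reduced calls to the `GapCVP′` decider
(`restrict_gapSVP_mem_PromiseBQP_of_gapCVP'`), unbundled to the eventual form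
(`exists_eventually_of_restrict_mem_PromiseBQP`). This is hypothesis `hG` of
`regev_lwe_to_gapSVP_quantum_of_dgs` / `_of_worstCase` (`RegevReduction.lean`).
[cite: Regev2009, §3.3 (p. 21, the GMSS99 sentence); MicciancioRegev2007 Lemma 5.22; GoldreichMicciancioSafraSeifert1999 Thm. 1; BennettBernsteinBrassardVazirani1997 Thm. 4.14] -/
theorem gmss_gapSVP_of_gapCVP'_quantum (γ : ℕ → ℝ)
    (h : ∃ Q : UniformQCircuitFamily, ∀ᶠ n : ℕ in atTop, ∀ p : GapCVPInstance, p.1.I.n = n →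
      (p ∈ GapCVP'.yes γ → 2 / 3 ≤ Q.acceptProb p.encode) ∧
      (p ∈ GapCVP'.no γ → Q.acceptProb p.encode ≤ 1 / 3)) :
    ∃ Q : UniformQCircuitFamily, ∀ᶠ n : ℕ in atTop, ∀ p : GapSVPInstance, p.1.n = n →
      (p ∈ GapSVP.yes γ → 2 / 3 ≤ Q.acceptProb p.encode) ∧
      (p ∈ GapSVP.no γ → Q.acceptProb p.encode ≤ 1 / 3) := by
  obtain ⟨Q, hQ⟩ := h
  obtain ⟨n₀, hn₀⟩ := eventually_atTop.1 hQ
  exact exists_eventually_of_restrict_mem_PromiseBQP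
    (restrict_gapSVP_mem_PromiseBQP_of_gapCVP' (Q := Q) (n₀ := n₀) fun p hp => hn₀ p.1.I.n hp p rfl)

end Regev2009

/-! ### Assembly: pqc.S19 (GapSVP form) from Thm 3.1 and Lemma 3.20 alone -/

section Assembly

variable (q : ℕ → ℕ) [∀ n, NeZero (q n)] (α : ℕ → ℝ) (m : ℕ → ℕ)

/-- **Assembly of pqc.S19 (GapSVP form) from Thm 3.1 (machine form `hB`) and Lemma 3.20 (machine
form `hL`) alone**, the [GMSS99] step being the theorem `Regev2009.gmss_gapSVP_of_gapCVP'_quantum`.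
Hypotheses `hB`, `hL` VERBATIM those of `regev_lwe_to_gapSVP_quantum_of_dgs` (`RegevReduction.lean`).
[cite: Regev2009, Thm 1.1 and §3.3 (Lemma 3.20 with GMSS99)] -/
theorem regev_lwe_to_gapSVP_quantum_of_dgs_tt
    (hB : ∀ (_ : IsPolyBounded m) (_ : IsPolyTimeParams q α m)
      (_ : ∀ᶠ n : ℕ in atTop, 0 < α n ∧ α n < 1 ∧ 2 * Real.sqrt n < α n * q n)
      (_ : ∃ Q : UniformQCircuitFamily, SearchLWESolves q (fun n => discretizedGaussian (q n) (α n))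
        m (fun n => Q.searchLWESolver n (q n) (m n)) fun _ => 2 / 3)
      (ε : ℕ → ℝ), IsNegligible ε → (∀ n, 0 < ε n) →
      ∃ (D : UniformQCircuitFamily) (ν : ℕ → ℝ), IsNegligible ν ∧ D.SamplesDGS (regevDGSBound α ε) ν)
    (hL : ∀ (γ : ℕ → ℝ), (∀ n, 1 ≤ γ n) →
      (∃ (D : UniformQCircuitFamily) (ν : ℕ → ℝ),
          IsNegligible ν ∧ D.SamplesDGS (Regev2009.dgsBoundDual γ) ν) →
      ∃ Q : UniformQCircuitFamily, ∀ᶠ n : ℕ in atTop, ∀ p : GapCVPInstance, p.1.I.n = n →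
        (p ∈ GapCVP'.yes (fun k => 100 * Real.sqrt k * γ k) → 2 / 3 ≤ Q.acceptProb p.encode) ∧
        (p ∈ GapCVP'.no (fun k => 100 * Real.sqrt k * γ k) → Q.acceptProb p.encode ≤ 1 / 3)) :
    regev_lwe_to_gapSVP_quantum q α m :=
  regev_lwe_to_gapSVP_quantum_of_dgs q α m hB hL fun γ _ h => Regev2009.gmss_gapSVP_of_gapCVP'_quantum γ h

/-- **Assembly of pqc.S19 (GapSVP form) from Thm 3.1 in Regev's worst-case form (`h₁`, `h₂`) and
Lemma 3.20 (`hL`) alone**: hypotheses VERBATIM those of `regev_lwe_to_gapSVP_quantum_of_worstCase`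
(`RegevReduction.lean`; `h₁`, `h₂` are also those of the SIVP form
`regev_lwe_to_sivp_quantum_of_worstCase`), the [GMSS99] step being the theorem
`Regev2009.gmss_gapSVP_of_gapCVP'_quantum`. Once `h₁`, `h₂`, `hL` are theorems of the tree,
`regev_lwe_to_gapSVP_quantum_holds` is this assembly applied to them.
[cite: Regev2009, Thm 3.1 (with §2 p. 12, Lemmas 3.6, 4.1, 4.3), Lemma 3.20 and §3.3] -/
theorem regev_lwe_to_gapSVP_quantum_of_worstCase_tt
    (h₁ : ∀ (_ : IsPolyBounded m) (_ : IsPolyTimeParams q α m)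
      (_ : ∀ᶠ n : ℕ in atTop, 0 < α n ∧ α n < 1 ∧ 2 * Real.sqrt n < α n * q n)
      (_ : ∃ Q : UniformQCircuitFamily, SearchLWESolves q (fun n => discretizedGaussian (q n) (α n))
        m (fun n => Q.searchLWESolver n (q n) (m n)) fun _ => 2 / 3),
      ∃ (W : UniformQCircuitFamily) (m' : ℕ → ℕ) (c : ℝ), IsPolyBounded m' ∧
        IsPolyTimeParams q α m' ∧ 0 < c ∧
        W.SolvesSearchLWEWorstCase q (fun n => discretizedGaussian (q n) (α n)) m'
          fun n => (2 : ℝ) ^ (-(c * n)))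
    (h₂ : ∀ (m' : ℕ → ℕ) (_ : IsPolyBounded m') (_ : IsPolyTimeParams q α m')
      (_ : ∀ᶠ n : ℕ in atTop, 0 < α n ∧ α n < 1 ∧ 2 * Real.sqrt n < α n * q n)
      (_ : ∃ (W : UniformQCircuitFamily) (c : ℝ), 0 < c ∧
        W.SolvesSearchLWEWorstCase q (fun n => discretizedGaussian (q n) (α n)) m'
          fun n => (2 : ℝ) ^ (-(c * n)))
      (ε : ℕ → ℝ), IsNegligible ε → (∀ n, 0 < ε n) →
      ∃ (D : UniformQCircuitFamily) (ν : ℕ → ℝ), IsNegligible ν ∧ D.SamplesDGS (regevDGSBound α ε) ν)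
    (hL : ∀ (γ : ℕ → ℝ), (∀ n, 1 ≤ γ n) →
      (∃ (D : UniformQCircuitFamily) (ν : ℕ → ℝ),
          IsNegligible ν ∧ D.SamplesDGS (Regev2009.dgsBoundDual γ) ν) →
      ∃ Q : UniformQCircuitFamily, ∀ᶠ n : ℕ in atTop, ∀ p : GapCVPInstance, p.1.I.n = n →
        (p ∈ GapCVP'.yes (fun k => 100 * Real.sqrt k * γ k) → 2 / 3 ≤ Q.acceptProb p.encode) ∧
        (p ∈ GapCVP'.no (fun k => 100 * Real.sqrt k * γ k) → Q.acceptProb p.encode ≤ 1 / 3)) :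
    regev_lwe_to_gapSVP_quantum q α m :=
  regev_lwe_to_gapSVP_quantum_of_worstCase q α m h₁ h₂ hL fun γ _ h => Regev2009.gmss_gapSVP_of_gapCVP'_quantum γ h

end Assembly

end Literature.Computability.Cryptography

end
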